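import Mathlib
import Summits.ValiantsHypothesis.ValiantsHypothesis.Theses.ProofCarryingSymmetry
import Summits.ValiantsHypothesis.ValiantsHypothesis.Theorems.ProofCarryingSymmetryRestorationQPDistStability
import Summits.ValiantsHypothesis.ValiantsHypothesis.Theorems.ProofCarryingSymmetryRestorationQPPCLayoutIso

/-!
# Route ProofCarryingSymmetry — crux `RestorationQP`, line `registered`: the line is a THEOREM at distributivity budget zero

Support file for the crux item `stmt-ValiantsHypothesis-10343` (lead c4, cycle 4).  The line splits
the crux as PROVABILITY (T′: quasi-polynomial `P_c(ℂ)` proofs of all invariance identities for some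
quasi-polynomial circuit of every invariant VP family) ∘ STABILITY (the bet S2⁗: such proofs can be
traded for a circuit whose unfoldings are invariant up to associativity, commutativity, units and
constants, i.e. inter-derivable in `P_f(ℂ)` WITHOUT DISTRIBUTIVITY A6) ∘ S3⁗ (proved, p157844: such
unfoldings ⇒ an `S_n`-symmetric Dawar–Wilsenach circuit of polynomial size).  The graded reading of the
bet meters the number `t` of distributivity instances an invariance proof needs.

`proofCarryingSymmetry_at_distBudgetZero`: at `t = 0` EVERYTHING the line asks for is a theorem, for
one and the same polynomial bound `(|C| + n + 2)^c` (`c = 72`): if for every `σ ∈ S_n` the unfoldings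
`(C ∘ σ)•` and `C•` are inter-derivable in `P_f(ℂ)` without A6, then
  (i) RESTORATION — an `S_n`-symmetric labelled circuit of size `≤ (|C|+n+2)^c` computes `Ĉ`
      (S3⁗, `stabilityAtDistEquiv`), and
 (ii) PROOF-CARRYING — some straight-line circuit `C'` of size `≤ (|C|+n+2)^c` computes `Ĉ`, has
      AC-invariant unfoldings (the conclusion of the cycle-1 bet S2″ with `t` forgotten) and
      `P_c(ℂ)` proofs of ALL its invariance identities of size `≤ (|C|+n+2)^c` (the conclusion of T′,
      polynomial form) — the symmetric circuit of (i) laid out and fed to the cycle-2 engine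
      `PCR.exists_piCircuit_pcProofs_of_isSymmetric`.
So the open content of both registered stubs lives entirely at `t ≥ 1`: the first graded instance
S3^(1) ("one ground instance `P(Q+R) = PQ + PR` added to the AC+units+constants congruence") is the
line's smallest open statement (CYCLE4-REPORT.md records its reduction to a covering-by-subgroups
question).  Everything proved; no named facts.
-/

-- single-problem summit: `Summit.ValiantsHypothesis.ValiantsHypothesis.…` is the namespace by design (D-0017)
set_option linter.dupNamespace false

namespace Summit.ValiantsHypothesis.ValiantsHypothesis.Theorems

open Literature.Computability.AlgebraicComplexity

/-- Size bookkeeping at `N ≤ m⁶`, `2 ≤ m`: `N·N·(N+2) ≤ m^19` and `310·(N+3)⁹ ≤ m^72`. [folklore] -/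
theorem budgetZero_bounds (m N : ℕ) (hm : 2 ≤ m) (hN : N ≤ m ^ 6) :
    N * N * (N + 2) ≤ m ^ 19 ∧ 310 * (N + 3) ^ 9 ≤ m ^ 72 := by
  have h64 : 64 ≤ m ^ 6 :=
    calc (64 : ℕ) = 2 ^ 6 := by norm_num
      _ ≤ m ^ 6 := Nat.pow_le_pow_left hm 6
  constructor
  · have hA : N + 2 ≤ 2 * m ^ 6 := by omega
    calc N * N * (N + 2) ≤ m ^ 6 * m ^ 6 * (2 * m ^ 6) :=
          Nat.mul_le_mul (Nat.mul_le_mul hN hN) hA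
      _ = 2 * m ^ 18 := by ring
      _ ≤ m * m ^ 18 := Nat.mul_le_mul_right _ hm
      _ = m ^ 19 := by ring
  · have hA : N + 3 ≤ 2 * m ^ 6 := by omega
    have hB : (N + 3) ^ 9 ≤ 2 ^ 9 * m ^ 54 :=
      calc (N + 3) ^ 9 ≤ (2 * m ^ 6) ^ 9 := Nat.pow_le_pow_left hA 9
        _ = 2 ^ 9 * m ^ 54 := by ring
    have hC : (310 * 2 ^ 9 : ℕ) ≤ m ^ 18 :=
      calc (310 * 2 ^ 9 : ℕ) ≤ 2 ^ 18 := by norm_num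
        _ ≤ m ^ 18 := Nat.pow_le_pow_left hm 18
    calc 310 * (N + 3) ^ 9 ≤ 310 * (2 ^ 9 * m ^ 54) := Nat.mul_le_mul_left 310 hB
      _ = (310 * 2 ^ 9) * m ^ 54 := by ring
      _ ≤ m ^ 18 * m ^ 54 := Nat.mul_le_mul_right _ hC
      _ = m ^ 72 := by ring

/-- **The line `registered` is a theorem at distributivity budget zero.**  If for every `σ ∈ S_n`
(diagonal action) the unfoldings `(C ∘ σ)•` and `C•` of a Hrubeš–Tzameret circuit `C` over `ℂ` are
inter-derivable in `P_f(ℂ)` with no instance of distributivity A6 (A1–A5, the unit laws A7–A9, the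
constant equations A10 and the rules all allowed), then with `m = |C| + n + 2`:
(i) an `S_n`-symmetric labelled arithmetic circuit of size `≤ m^72` computes `Ĉ` (restoration), and
(ii) some straight-line circuit `C'` of size `≤ m^72` computes `Ĉ`, has unfoldings `(C' ∘ σ)•`, `C'•`
equal modulo associativity–commutativity for every `σ`, and has `P_c(ℂ)` proofs of every invariance
identity `C' ∘ σ = C'` of size `≤ m^72` (proof-carrying symmetry).  (i) is S3⁗
(`stabilityAtDistEquiv`, exponent 6); (ii) lays the symmetric circuit of (i) out as a straight-line
program that proves its own symmetry (`PCR.exists_piCircuit_pcProofs_of_isSymmetric`: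
size `≤ N²(N+2)`, proofs `≤ 310(N+3)⁹` at `N ≤ m⁶`). [folklore] -/
theorem proofCarryingSymmetry_at_distBudgetZero : ∃ c : ℕ, ∀ (n : ℕ) (C : PICircuit ℂ (Fin n × Fin n)), (∀ σ : Equiv.Perm (Fin n), (pfSystem ℂ (Fin n × Fin n)).Provable (C.rename fun x : Fin n × Fin n => σ • x).unfold C.unfold ⊤ (fun s => if s = PIAxiom.A6 then 0 else ⊤)) → (∃ (G : Type) (_ : Fintype G) (D : LabelledArithCircuit ℂ (Fin n × Fin n) Unit G), D.IsSymmetric (Equiv.Perm (Fin n)) ∧ D.eval (D.output ()) = C.eval ∧ Fintype.card G ≤ (C.size + n + 2) ^ c) ∧ ∃ C' : PICircuit ℂ (Fin n × Fin n), C'.eval = C.eval ∧ C'.size ≤ (C.size + n + 2) ^ c ∧ (∀ σ : Equiv.Perm (Fin n), ACStability.ACEq (C'.rename fun x : Fin n × Fin n => σ • x).unfold C'.unfold) ∧ ∀ σ : Equiv.Perm (Fin n), HasPCProofOfSize (C'.rename fun x : Fin n × Fin n => σ • x) C' ((C.size + n + 2) ^ c) := by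
  refine ⟨72, fun n C h => ?_⟩
  -- (i): S3⁗ with its exponent 6, read off the generic core directly so that the bound is explicit
  obtain ⟨G, hG, D, hsym, hev, hcard⟩ :=
    ACStability.exists_isSymmetric_of_ucEq (Γ := Equiv.Perm (Fin n)) C
      fun σ => ACStability.ucEq_of_pfProvable (fun s hs => if_pos hs) (h σ)
  have hcard6 : Fintype.card G ≤ (C.size + n + 2) ^ 6 :=
    hcard.trans (ACStability.dist_gate_bound C.size n)
  have hm : 2 ≤ C.size + n + 2 := by omega
  obtain ⟨h19, h72⟩ := budgetZero_bounds (C.size + n + 2) (Fintype.card G) hm hcard6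
  refine ⟨⟨G, hG, D, hsym, hev, hcard6.trans (Nat.pow_le_pow_right (by omega) (by norm_num))⟩, ?_⟩
  -- (ii): the symmetric circuit proves its own symmetry
  obtain ⟨C', -, hC'ev, hC'size, hC'ac, hC'pc⟩ :=
    PCR.exists_piCircuit_pcProofs_of_isSymmetric (Γ := Equiv.Perm (Fin n)) D hsym () (fun _ => rfl)
  refine ⟨C', hC'ev.trans hev, hC'size.trans (h19.trans (Nat.pow_le_pow_right (by omega) (by norm_num))),
    hC'ac, fun σ => (hC'pc σ).mono h72⟩

end Summit.ValiantsHypothesis.ValiantsHypothesis.Theorems
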